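import Summits.ResolutionOfSingularities.ResolutionOfSingularities.Theorems.HilbertSamuelEliminationSigmaMaxModificationsCorridor3WLadderRecognitionNearLocusWUnit
import Summits.ResolutionOfSingularities.ResolutionOfSingularities.Theorems.HilbertSamuelEliminationSigmaMaxModificationsCorridor3WLadderStrataCentreCurveDominantCleanGeomDir
import Summits.ResolutionOfSingularities.ResolutionOfSingularities.Theorems.HilbertSamuelEliminationSigmaMaxModificationsCorridor3WLadderStrataNearFibreGeomDir
import Summits.ResolutionOfSingularities.ResolutionOfSingularities.Theorems.HilbertSamuelEliminationSigmaMaxModificationsCorridor3WLadderMovingTwo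
import Literature.AlgebraicGeometry.Resolution.PointBlowupHsFunMono
import Literature.AlgebraicGeometry.Resolution.DirectrixSchemeLocal
import HarnessLib

/-!
# [OURS · L1 W4.2] RECOGNITION-GEOMETRY (R2♯): THE NEAR LOCUS OVER A CURVE CENTRE IN THE (F1♯) REGIME — the characteristic-`2` row
# `stub_Wlow3M_two` (crux chain w42, line `w_ladder`; `--supports stmt-…-19249`, helper)

OURS (cell res-hironaka, slot W4.2, seat res-L1-w42-stub-2 gen 4); NOT statements of H. Hironaka's manuscript [Hironaka2017]
nor of [CossartJannsenSaito2020]. AI-drafted, weaker than expert review. Sorry-free PROOF file (no new definition).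

The waiting-tolerant F-parametric (R2) (`…RecognitionNearLocusW{Fibres,Curve,Shape,Unit}`) INSTANTIATED at `F := GeomDirHypothesis` («`char κ(x) = 0 ∨
ē_x(X) + 2 ≤ 2·char κ(x)`», res-L1-w42-stub-3), the point hypothesis of the row `stub_Wlow3M_two` (RULING v3.14-17 (FD): residue =
`Seg.UnitRecognitionAtQM 2 ⊤` + (K-ctr-cv)β; this file is the geometric half of that recognition). Binders = the row's OURS carriers
(conjecture-class, consumed BY NAME as hypotheses, NOT asserted): `Theorem314_nearFibre_geomDir` (stub-4), `Theorem314_geomDir` (stub-3),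
`Thm314_point_locus_geomDir` (stub-3) — the last through res-L1-w42-stub-4's P-b♯ door
`Moving.isIso_residueFieldMap_of_near_of_geomDirHypothesis` (p529462) — plus the printed CJS Thm. 3.6 (`h36`, F-65) and Thm. 3.10 (4)
(`h3104`) and the PROVED P-a `ProjDir_projLine_holds`.

* **`geomDirHypothesis_of_mem_nearLocus`** — (F1♯) HOLDS AT EVERY NEAR POINT of a tower over `x` with `ē_x ≤ 2` and `dim X_0 ≤ 3`: closed
  near points have `ē ≤ ē_x ≤ 2`, non-closed ones have `ē ≤ dim 𝒪 ≤ 2` (stub-4's `geomDirDim_le_two_of_specializes`) — so the standing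
  hypothesis `hF` of the F-files is DISCHARGED in this regime;
* `theorem314_geomDir_binder` — the carrier `Theorem314_geomDir` in the binder shape of the F-files;
* **`inducesIsoOn_of_unit_geomDir`**, **`dichPlus_of_unit_geomDir`**, **`not_surjective_of_unit_geomDir`**, `dichPlus_nearLocus_succ_geomDir`
  — CJS Def. 6.38 (iv), (Dich⁺) (stub-1's (Dich)/(RegN) inputs) and Def. 6.38 (v) for a tower with the unit data (ii)–(iii), in ANY
  characteristic, modulo the three (F1♯) carriers, CJS Thm. 3.6 and Thm. 3.10 (4).

## References

* V. Cossart, U. Jannsen, S. Saito, LNM 2270 (2020): Thm. 3.6, Thm. 3.10 (4), Thm. 3.14, Def. 6.38 (ii)–(v), p. 94, pp. 103–105.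
  [CossartJannsenSaito2020]
* The Stacks Project, Tag 02OS (blow-up is an isomorphism off the centre). [StacksProject]
-/

noncomputable section

-- namespace `…Corridor3.Helpers` re-enters `…Corridor3`
set_option linter.dupNamespace false

open CategoryTheory AlgebraicGeometry TopologicalSpace IsLocalRing
open Literature.AlgebraicGeometry.Resolution
open Scheme.IdealSheafData

universe u

open Literature.AlgebraicGeometry.CossartJannsenSaito2020
open Summit.ResolutionOfSingularities.ResolutionOfSingularities.Theorems.SigmaMaxModificationsCorridor3.Moving

namespace Summit.ResolutionOfSingularities.ResolutionOfSingularities.Theorems.SigmaMaxModificationsCorridor3.Helpers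

namespace BlowupTowerNearGeomDir

variable (T : BlowupTower.{u}) {N : ℕ}

/-! ## §1. (F1♯) at every near point -/

/-- **(F1♯) holds at every near point** of a tower of permissible blow-ups over a point `x` with `ē_x(X_0) ≤ 2` when `dim X_0 ≤ 3`:
`GeomDirHypothesis (X_i) y` for all `y ∈ N_i(x)` — at closed `y` since `ē_y ≤ ē_x ≤ 2` (`geomDirHypothesis_of_geomDirDim_le_two`), at
non-closed `y` since `ē_y ≤ dim 𝒪_{X_i,y} ≤ 2` (res-L1-w42-stub-4's `geomDirDim_le_two_of_specializes`). This DISCHARGES the standing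
hypothesis `hF` of the F-parametric files in the characteristic-`2` row. [cite: CossartJannsenSaito2020, Def. 2.21, Thm. 3.10 (4)] -/
theorem geomDirHypothesis_of_mem_nearLocus (h3104 : CossartJannsenSaito2020_thm_3_10_4.{u}) (hkey : KeySetting T N)
    (hperm : ∀ j, IdealSheafData.IsPermissible (T.centreIdeal j))
    (hdim3 : topologicalKrullDim ↥(T.X 0) ≤ ((3 : ℕ) : WithBot ℕ∞)) {x : T.X 0} (hē : T.geomDirDimAt 0 x ≤ 2) :
    ∀ i, ∀ y ∈ T.nearLocus N x i, @GeomDirHypothesis (T.X i) (T.ln i) y := by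
  haveI : ∀ j, IsLocallyNoetherian (T.X j) := T.ln
  have hdim : ∀ i, topologicalKrullDim ↥(T.X i) ≤ ((3 : ℕ) : WithBot ℕ∞) := by
    intro i
    induction i with
    | zero => exact hdim3
    | succ i ih => exact (T.isBlowup i).topologicalKrullDim_le_of_isLocallyNoetherian ih
  intro i y hy
  by_cases hycl : IsClosed ({y} : Set (T.X i))
  · exact geomDirHypothesis_of_geomDirDim_le_two ((BlowupTowerNearW.geomDirDim_le_of_mem_nearLocus h3104 hkey hperm x i y hy hycl).trans hē)
  · -- a non-closed point has a proper specialisation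
    have hne : closure ({y} : Set (T.X i)) ≠ {y} := fun h => hycl (h ▸ isClosed_closure)
    obtain ⟨z, hz, hzy⟩ : ∃ z ∈ closure ({y} : Set (T.X i)), z ≠ y := by
      by_contra h
      exact hne (subset_antisymm (fun z hz => Set.mem_singleton_iff.mpr (by_contra fun hzy => h ⟨z, hz, hzy⟩)) subset_closure)
    have hsp : y ⤳ z := specializes_iff_mem_closure.mpr hz
    exact geomDirHypothesis_of_geomDirDim_le_two (geomDirDim_le_two_of_specializes hsp (Ne.symm hzy) (hdim i))

/-! ## §2. The carriers in binder shape -/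

/-- The carrier `Theorem314_geomDir` (res-L1-w42-stub-3) in the binder shape `h314` of the F-files. [cite: CossartJannsenSaito2020, Thm. 3.14] -/
theorem theorem314_geomDir_binder (hF314 : Theorem314_geomDir.{u}) :
    ∀ (X X' : Scheme.{u}) [IsLocallyNoetherian X] [IsLocallyNoetherian X'] (π : X' ⟶ X) (D : X.IdealSheafData),
      Scheme.IsExcellent X → IdealSheafData.IsPermissible D → IsBlowup π D →
        ∀ N : ℕ, topologicalKrullDim X ≤ (N : WithBot ℕ∞) →
          ∀ x' : X', π.base x' ∈ D.support → GeomDirHypothesis X (π.base x') →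
            Scheme.hsFun X' N x' = Scheme.hsFun X N (π.base x') →
              ringKrullDim (X.presheaf.stalk (π.base x') ⧸ stalkIdeal D (π.base x')) <
                (Scheme.dirDim X (π.base x') : WithBot ℕ∞) :=
  fun X X' _ _ π D hX hD hπ N hN x' hx' hg hnear => hF314 X X' π D N x' (π.base x') hX hD hπ hN rfl hx' hg hnear

/-! ## §3. The unit-level clauses in the (F1♯) regime -/

section UnitGeomDir

variable {T}

/-- **CJS Def. 6.38 (iv) in the (F1♯) regime (row `stub_Wlow3M_two`, any characteristic)**: for a tower with `X_0` noetherian excellent of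
dimension `≤ 3` (`N ≥ dim`), permissible centres, closed strata, `C_0 = {x}` (`x` closed, `e_x = 2`, `ē_x ≤ 2`), `C_1 = ℙ(Dir_x)`, `N_1(x) ≠ ∅`,
`C_i = N_i(x)` (`2 ≤ i ≤ q`), a CLOSED near point NOT isolated in `N_i(x)` at every `2 ≤ i ≤ q`: **`π_{j+1} : C_{j+1} ⥲ C_j` for all
`1 ≤ j`, `j + 1 ≤ q`** — modulo the (F1♯) carriers `Theorem314_nearFibre_geomDir`, `Theorem314_geomDir`, `Thm314_point_locus_geomDir` and the
printed CJS Thm. 3.6 / Thm. 3.10 (4). [cite: CossartJannsenSaito2020, Def. 6.38 (ii)–(iv), p. 104] -/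
theorem inducesIsoOn_of_unit_geomDir [IsNoetherian (T.X 0)] (hFf : Theorem314_nearFibre_geomDir.{u}) (hF314 : Theorem314_geomDir.{u})
    (h314ptG : Thm314_point_locus_geomDir.{u}) (h36 : CossartJannsenSaito2020_thm_3_6.{u})
    (h3104 : CossartJannsenSaito2020_thm_3_10_4.{u}) (hkey : KeySetting T N)
    (hperm : ∀ j, IdealSheafData.IsPermissible (T.centreIdeal j))
    (hcl : ∀ (j : ℕ) (μ : ℕ → ℕ), IsClosed (Scheme.hsStratumGE (T.X j) N μ))
    (hdim3 : topologicalKrullDim ↥(T.X 0) ≤ ((3 : ℕ) : WithBot ℕ∞))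
    {x : T.X 0} (hx : IsClosed ({x} : Set (T.X 0))) (he : T.dirDimAt 0 x = 2) (hē : T.geomDirDimAt 0 x ≤ 2)
    (hC0 : T.C 0 = {x}) (hC1 : T.C 1 = T.projDir x) (hN1 : (T.nearLocus N x 1).Nonempty)
    {q : ℕ} (hCq : ∀ i, 2 ≤ i → i ≤ q → T.C i = T.nearLocus N x i)
    (hniso : ∀ i, 2 ≤ i → i ≤ q → ∃ z ∈ T.nearLocus N x i, IsClosed ({z} : Set (T.X i)) ∧
      ¬ ∃ U : Set (T.X i), IsOpen U ∧ U ∩ T.nearLocus N x i = {z}) :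
    ∀ j, 1 ≤ j → j + 1 ≤ q → InducesIsoOn (T.π j) (T.C (j + 1)) (T.isClosed_C (j + 1)) (T.C j) (T.isClosed_C j) :=
  BlowupTowerNearW.inducesIsoOn_of_unit (fun X _ y => GeomDirHypothesis X y) hFf
    (isIso_residueFieldMap_of_near_of_geomDirHypothesis h314ptG) (theorem314_geomDir_binder hF314) h314ptG h36 h3104 hkey hperm hcl hx
    (geomDirHypothesis_of_mem_nearLocus T h3104 hkey hperm hdim3 hē) he hē hC0 hC1 hN1 hCq hniso

/-- **(Dich⁺) in the (F1♯) regime** at every stage `1 ≤ j ≤ q` (hypotheses of `inducesIsoOn_of_unit_geomDir`): `N_{j+1}(x)` is EITHER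
irreducible, nontrivial, with a non-closed point, and regular (reduced structure), OR a finite set of closed points — stub-1's (Dich)/(RegN)
inputs at `p = 2` (transfer to the global stages by `…RecognitionNearLocusLocalize`). [cite: CossartJannsenSaito2020, Def. 6.38 (iii)–(iv), p. 94, p. 104] -/
theorem dichPlus_of_unit_geomDir [IsNoetherian (T.X 0)] (hFf : Theorem314_nearFibre_geomDir.{u}) (hF314 : Theorem314_geomDir.{u})
    (h314ptG : Thm314_point_locus_geomDir.{u}) (h36 : CossartJannsenSaito2020_thm_3_6.{u})
    (h3104 : CossartJannsenSaito2020_thm_3_10_4.{u}) (hkey : KeySetting T N)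
    (hperm : ∀ j, IdealSheafData.IsPermissible (T.centreIdeal j))
    (hcl : ∀ (j : ℕ) (μ : ℕ → ℕ), IsClosed (Scheme.hsStratumGE (T.X j) N μ))
    (hdim3 : topologicalKrullDim ↥(T.X 0) ≤ ((3 : ℕ) : WithBot ℕ∞))
    {x : T.X 0} (hx : IsClosed ({x} : Set (T.X 0))) (he : T.dirDimAt 0 x = 2) (hē : T.geomDirDimAt 0 x ≤ 2)
    (hC0 : T.C 0 = {x}) (hC1 : T.C 1 = T.projDir x) (hN1 : (T.nearLocus N x 1).Nonempty)
    {q : ℕ} (hCq : ∀ i, 2 ≤ i → i ≤ q → T.C i = T.nearLocus N x i)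
    (hniso : ∀ i, 2 ≤ i → i ≤ q → ∃ z ∈ T.nearLocus N x i, IsClosed ({z} : Set (T.X i)) ∧
      ¬ ∃ U : Set (T.X i), IsOpen U ∧ U ∩ T.nearLocus N x i = {z})
    {j : ℕ} (hj : 1 ≤ j) (hjq : j ≤ q) :
    (IsIrreducible (T.nearLocus N x (j + 1)) ∧ (T.nearLocus N x (j + 1)).Nontrivial ∧
        (∃ z ∈ T.nearLocus N x (j + 1), ¬ IsClosed ({z} : Set (T.X (j + 1)))) ∧
        ∀ hN : IsClosed (T.nearLocus N x (j + 1)),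
          Scheme.IsRegular (vanishingIdeal (⟨T.nearLocus N x (j + 1), hN⟩ : Closeds (T.X (j + 1)))).subscheme) ∨
      ((T.nearLocus N x (j + 1)).Finite ∧ ∀ z ∈ T.nearLocus N x (j + 1), IsClosed ({z} : Set (T.X (j + 1)))) :=
  BlowupTowerNearW.dichPlus_of_unit (fun X _ y => GeomDirHypothesis X y) hFf
    (isIso_residueFieldMap_of_near_of_geomDirHypothesis h314ptG) (theorem314_geomDir_binder hF314) h314ptG h36 h3104 hkey hperm hcl hx
    (geomDirHypothesis_of_mem_nearLocus T h3104 hkey hperm hdim3 hē) he hē hC0 hC1 hN1 hCq hniso hj hjq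

/-- **CJS Def. 6.38 (v) in the (F1♯) regime**: `¬ (C_q ⊆ π_{q+1}(N_{q+1}(x)))` given in addition an ISOLATED closed point of `N_{q+1}(x)`
(the marked point at the terminal `Iso` stage). [cite: CossartJannsenSaito2020, Def. 6.38 (v), p. 105] -/
theorem not_surjective_of_unit_geomDir [IsNoetherian (T.X 0)] (hFf : Theorem314_nearFibre_geomDir.{u})
    (h314ptG : Thm314_point_locus_geomDir.{u}) (h36 : CossartJannsenSaito2020_thm_3_6.{u})
    (h3104 : CossartJannsenSaito2020_thm_3_10_4.{u}) (hkey : KeySetting T N)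
    (hperm : ∀ j, IdealSheafData.IsPermissible (T.centreIdeal j))
    (hcl : ∀ (j : ℕ) (μ : ℕ → ℕ), IsClosed (Scheme.hsStratumGE (T.X j) N μ))
    (hdim3 : topologicalKrullDim ↥(T.X 0) ≤ ((3 : ℕ) : WithBot ℕ∞))
    {x : T.X 0} (hx : IsClosed ({x} : Set (T.X 0))) (he : T.dirDimAt 0 x = 2) (hē : T.geomDirDimAt 0 x ≤ 2)
    (hC0 : T.C 0 = {x}) (hC1 : T.C 1 = T.projDir x) (hN1 : (T.nearLocus N x 1).Nonempty)
    {q : ℕ} (hq : 1 ≤ q) (hCq : ∀ i, 2 ≤ i → i ≤ q → T.C i = T.nearLocus N x i)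
    (hniso : ∀ i, 2 ≤ i → i ≤ q → ∃ z ∈ T.nearLocus N x i, IsClosed ({z} : Set (T.X i)) ∧
      ¬ ∃ U : Set (T.X i), IsOpen U ∧ U ∩ T.nearLocus N x i = {z})
    {z : T.X (q + 1)} (hzcl : IsClosed ({z} : Set (T.X (q + 1))))
    (hiso : ∃ U : Set (T.X (q + 1)), IsOpen U ∧ U ∩ T.nearLocus N x (q + 1) = {z}) :
    ¬ (T.C q ⊆ (T.π q).base '' T.nearLocus N x (q + 1)) :=
  BlowupTowerNearW.not_surjective_of_unit (fun X _ y => GeomDirHypothesis X y) hFf h314ptG h36 h3104 hkey hperm hcl hx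
    (geomDirHypothesis_of_mem_nearLocus T h3104 hkey hperm hdim3 hē) he hē hC0 hC1 hN1 hq hCq hniso hzcl hiso

/-- **(Dich⁺) at ONE step in the (F1♯) regime** (for stub-1's interleaved induction): standing hypotheses of the F-files at stage `j`
(`N_j(x) ⊆ C_j ⊆ N_j(x)`, `C_j` irreducible, nontrivial, non-generic points closed). [cite: CossartJannsenSaito2020, p. 94, p. 104] -/
theorem dichPlus_nearLocus_succ_geomDir [IsNoetherian (T.X 0)] (hFf : Theorem314_nearFibre_geomDir.{u}) (hF314 : Theorem314_geomDir.{u})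
    (h314ptG : Thm314_point_locus_geomDir.{u}) (h36 : CossartJannsenSaito2020_thm_3_6.{u})
    (h3104 : CossartJannsenSaito2020_thm_3_10_4.{u}) (hkey : KeySetting T N)
    (hperm : ∀ j, IdealSheafData.IsPermissible (T.centreIdeal j))
    (hcl : ∀ (j : ℕ) (μ : ℕ → ℕ), IsClosed (Scheme.hsStratumGE (T.X j) N μ))
    (hdim3 : topologicalKrullDim ↥(T.X 0) ≤ ((3 : ℕ) : WithBot ℕ∞))
    {x : T.X 0} (hx : IsClosed ({x} : Set (T.X 0))) (hē : T.geomDirDimAt 0 x ≤ 2) {j : ℕ}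
    (hNC : T.nearLocus N x j ⊆ T.C j) (hCN : T.C j ⊆ T.nearLocus N x j)
    (hirr : IsIrreducible (T.C j)) (hnt : (T.C j).Nontrivial)
    (hpts : ∀ y ∈ T.C j, ¬ IsGenericPoint y (T.C j) → IsClosed ({y} : Set (T.X j))) :
    (IsIrreducible (T.nearLocus N x (j + 1)) ∧ (T.nearLocus N x (j + 1)).Nontrivial ∧
        (∃ z ∈ T.nearLocus N x (j + 1), ¬ IsClosed ({z} : Set (T.X (j + 1)))) ∧
        ∀ hN : IsClosed (T.nearLocus N x (j + 1)),
          Scheme.IsRegular (vanishingIdeal (⟨T.nearLocus N x (j + 1), hN⟩ : Closeds (T.X (j + 1)))).subscheme) ∨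
      ((T.nearLocus N x (j + 1)).Finite ∧ ∀ z ∈ T.nearLocus N x (j + 1), IsClosed ({z} : Set (T.X (j + 1)))) :=
  BlowupTowerNearW.dichPlus_nearLocus_succ (fun X _ y => GeomDirHypothesis X y) hFf
    (isIso_residueFieldMap_of_near_of_geomDirHypothesis h314ptG) (theorem314_geomDir_binder hF314) h36 h3104 hkey hperm hcl hx
    (geomDirHypothesis_of_mem_nearLocus T h3104 hkey hperm hdim3 hē) hē hNC hCN hirr hnt hpts

end UnitGeomDir

end BlowupTowerNearGeomDir

end Summit.ResolutionOfSingularities.ResolutionOfSingularities.Theorems.SigmaMaxModificationsCorridor3.Helpers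

end
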